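import Mathlib.GroupTheory.Index
import Mathlib.GroupTheory.Coset.Basic
import Mathlib.GroupTheory.QuotientGroup.Defs
import Mathlib.GroupTheory.SpecificGroups.Dihedral
import Mathlib.Algebra.Group.Subgroup.Pointwise
import Mathlib.Data.Nat.Prime.Basic
import Mathlib.Tactic.Group
import Mathlib.Tactic.Ring
import Mathlib.Tactic.Linarith
import Literature.Computability.AlgebraicComplexity.CohnUmansDihedralSubgroupTPP
import HarnessLib

/-!
# Murthy 2025, Thm. 4.1: the subgroup triple-product ratio of a finite group with an abelian normal
subgroup of prime index `p` is at most `p² / (2p − 1)`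

Topic `Literature/Computability/AlgebraicComplexity` (group-theoretic matrix multiplication; TPP
capacity), namespace `Literature.Computability.AlgebraicComplexity.Murthy2025`.

S. R. Murthy, *A note on the triple product property for finite groups with abelian normal subgroups
of prime index*, arXiv:2512.16730v7 [math.GR] (9 Jan 2026).  With `β₀(G)` "the largest size of a TPP
triple of `G` composed only of subgroups" and `ρ₀(G) := β₀(G)/|G|` (eqs. (1.3)–(1.4), p. 2), the note
proves (verbatim, p. 7):

> **Theorem 4.1.** If `G` is a group with an abelian normal subgroup `H` of prime index `p` then
> `ρ₀(G) ≤ p²/(2p−1)` where equality `ρ₀(G) = p²/(2p−1)` implies that `2p−1` divides `|H|`, and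
> `|G| = p(2p−1)m` where `m` is the order of the proper subgroup of `H` associated with the
> `H`-restriction of the subgroup TPP triple of `G` through which the equality is achieved.

and (p. 10)

> **Corollary 4.3.** (1) If `G` is a group with an abelian normal subgroup `H` of prime index `p` and
> `(2p−1) ∤ |G|` […] then `ρ₀(G) ≤ ½p`. (2) If `G` is a `p`-group with an abelian subgroup of index
> `p` then `ρ₀(G) = 1`.

For `p = 2` this is the subgroup half of the Hedtke–Murthy conjecture `ρ ≤ 4/3` for groups with a
cyclic subgroup of index `2` (HM12 Conj. 7.5/7.6 = Conj. 1.3 of the note, p. 3); Example 4.2 (p. 9)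
shows that `4/3` is attained (`D_{6m}`).

## What is here (all proved; 0 named facts)

For a finite group `G`, a normal subgroup `H` with `[IsMulCommutative H]` of prime index `p`, and
subgroups `S, T, U ≤ G` with the subgroup triple product property (the tree's
`DihedralSubgroups.SubgroupTPP`: `s t u = 1` with `s ∈ S, t ∈ T, u ∈ U` only for `s = t = u = 1`,
eq. (1.2) of the note):

* `Murthy2025_thm41`: `(2p − 1) · |S| |T| |U| ≤ p² · |G|` (Thm. 4.1, cleared of denominators);
* `Murthy2025_thm41_eq`: if equality holds then `2p − 1 ∣ |H|` and `|G| = p (2p−1) m` with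
  `m = |S ∩ H| |T ∩ H| |U ∩ H|` (= the order of `S₀T₀U₀`; Thm. 4.1, second clause);
* `Murthy2025_cor43_1`: if `2p − 1 ∤ |G|` then `2 · |S| |T| |U| ≤ p · |G|` (Cor. 4.3 (1));
* `Murthy2025_cor43_2`: if `|G| = pⁿ` then `|S| |T| |U| ≤ |G|` (Cor. 4.3 (2); normality of the
  index-`p` subgroup is kept as a hypothesis — in print it is derived from maximality);
* `Murthy2025_example42_dihedral3`: the bound is attained for `p = 2` by the three reflection
  subgroups of `D₆` (`3 · 8 = 4 · 6`; Example 4.2 with `m = 1`, = CU03 Prop. 18's exception `m = 3`).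

The proof is the printed one (§3–§4): `S₀ := S ∩ H`, `T₀`, `U₀`; the `H`-supports have size
`σ, τ, υ ∈ {1, p}` (`le_or_sup_eq_top`, `card_eq_of_sup_eq_top` = Obs. 3.2 (1)–(2)); `S₀T₀U₀` is a
subgroup of `H` of order `|S₀||T₀||U₀|` (`restrictedProduct`, `card_restrictedProduct` = Prop. 2.5 (2)
applied in `H`, Obs. 3.2 (3)); Lemma 3.3 (1)/(2)/(3) are the three "rearranged TPP words"
`word_one`, `word_two`, `word_three`; the `2p − 1` pairwise distinct cosets
`S₀T₀U₀, sₓ⁻¹tₓ S₀T₀U₀, s_y⁻¹u_y S₀T₀U₀` (`x, y ∉ H`) are counted in `H ⧸ S₀T₀U₀` (`core`, case (ii)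
of the printed proof; case (i) uses Lemma 3.3 (1) only), and the case analysis on `σ, τ, υ` is
`Murthy2025.cases`.  Permutation invariance (Obs. 2.3 (1)) for subgroups: `subgroupTPP_rotate`,
`subgroupTPP_swap`.

Not formalised: Conj. 5.1 (all TPP triples, cyclic normal subgroup of prime index) — an open
conjecture, not Literature; Example 4.2 for general `m` (`D_{6m}`).

## References
* S. R. Murthy, arXiv:2512.16730v7 (2026): Def. 1.1 and eqs. (1.2)–(1.4) (p. 2), Obs. 2.3, Obs. 2.4,
  Prop. 2.5 (p. 4), Def. 3.1, Obs. 3.2 (p. 5), Lemma 3.3 (pp. 6–7), Thm. 4.1 (pp. 7–8), Example 4.2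
  (p. 9), Cor. 4.3 (p. 10). [Murthy2025TPPIndexP]
* H. Cohn, C. Umans, FOCS 2003, arXiv:math/0307321, Def. 2.1, Lemma 2.1, Lemma 3.1, Prop. 18.
  [CohnUmans2003]
* P. M. Neumann, LMS J. Comput. Math. 14 (2011) 232–237, Obs. 4.1 (coset decomposition). [Neumann2011]
* I. Hedtke, S. Murthy, Groups Complex. Cryptol. 4 (2012), Conj. 7.5–7.6. [HedtkeMurthy2012]
-/

namespace Literature.Computability.AlgebraicComplexity

namespace Murthy2025

open DihedralSubgroups

variable {G : Type*} [Group G]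

/-! ### Permutation invariance of the subgroup TPP (Obs. 2.3 (1)) -/

/-- Cyclic permutation: `(S, T, U)` TPP ⇒ `(T, U, S)` TPP (conjugate the word by `a`).
[cite: Murthy2025TPPIndexP, Obs. 2.3 (1)] [cite: CohnUmans2003, Lemma 2.1] -/
theorem subgroupTPP_rotate {S T U : Subgroup G} (h : SubgroupTPP S T U) : SubgroupTPP T U S := by
  intro b hb c hc a ha habc
  have h1 : a * b * c = 1 := by
    calc a * b * c = a * (b * c * a) * a⁻¹ := by group
      _ = 1 := by rw [habc]; group
  obtain ⟨ha1, hb1, hc1⟩ := h a ha b hb c hc h1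
  exact ⟨hb1, hc1, ha1⟩

/-- Transposition of the last two members: `(S, T, U)` TPP ⇒ `(S, U, T)` TPP (invert the word and
conjugate). [cite: Murthy2025TPPIndexP, Obs. 2.3 (1)] [cite: CohnUmans2003, Lemma 2.1] -/
theorem subgroupTPP_swap {S T U : Subgroup G} (h : SubgroupTPP S T U) : SubgroupTPP S U T := by
  intro a ha c hc b hb hacb
  have h1 : a⁻¹ * b⁻¹ * c⁻¹ = 1 := by
    calc a⁻¹ * b⁻¹ * c⁻¹ = a⁻¹ * (a * c * b)⁻¹ * a := by group
      _ = 1 := by rw [hacb]; group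
  obtain ⟨h3, h4, h5⟩ := h a⁻¹ (inv_mem ha) b⁻¹ (inv_mem hb) c⁻¹ (inv_mem hc) h1
  exact ⟨inv_eq_one.1 h3, inv_eq_one.1 h5, inv_eq_one.1 h4⟩

/-! ### The subgroup `S₀T₀U₀` of an abelian `H` (Prop. 2.5 (2), Obs. 3.2 (3)) -/

section Abelian

variable (H : Subgroup G) [IsMulCommutative H]

/-- Six elements of the abelian subgroup `H` can be regrouped. [folklore] -/
private theorem mul_mul_mul_comm_mem {s t u s' t' u' : G} (hs' : s' ∈ H) (ht : t ∈ H) (hu : u ∈ H)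
    (ht' : t' ∈ H) :
    s * t * u * (s' * t' * u') = s * s' * (t * t') * (u * u') := by
  have c1 : u * s' = s' * u := setLike_mul_comm hu hs'
  have c2 : t * s' = s' * t := setLike_mul_comm ht hs'
  have c3 : u * t' = t' * u := setLike_mul_comm hu ht'
  calc s * t * u * (s' * t' * u') = s * t * (u * s') * t' * u' := by group
    _ = s * t * (s' * u) * t' * u' := by rw [c1]
    _ = s * (t * s') * (u * t') * u' := by group
    _ = s * (s' * t) * (t' * u) * u' := by rw [c2, c3]
    _ = s * s' * (t * t') * (u * u') := by group

/-- The inverse of a product of three elements of the abelian `H`. [folklore] -/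
private theorem inv_mul_mul_mem {s t u : G} (hs : s ∈ H) (ht : t ∈ H) (hu : u ∈ H) :
    (s * t * u)⁻¹ = s⁻¹ * t⁻¹ * u⁻¹ := by
  have c1 : t⁻¹ * s⁻¹ = s⁻¹ * t⁻¹ := setLike_mul_comm (inv_mem ht) (inv_mem hs)
  have c2 : u⁻¹ * s⁻¹ = s⁻¹ * u⁻¹ := setLike_mul_comm (inv_mem hu) (inv_mem hs)
  have c3 : u⁻¹ * t⁻¹ = t⁻¹ * u⁻¹ := setLike_mul_comm (inv_mem hu) (inv_mem ht)
  calc (s * t * u)⁻¹ = (u⁻¹ * t⁻¹) * s⁻¹ := by group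
    _ = (t⁻¹ * u⁻¹) * s⁻¹ := by rw [c3]
    _ = t⁻¹ * (u⁻¹ * s⁻¹) := by group
    _ = t⁻¹ * (s⁻¹ * u⁻¹) := by rw [c2]
    _ = (t⁻¹ * s⁻¹) * u⁻¹ := by group
    _ = (s⁻¹ * t⁻¹) * u⁻¹ := by rw [c1]

/-- **`S₀T₀U₀`** for `S₀ = S ∩ H`, `T₀ = T ∩ H`, `U₀ = U ∩ H` inside the abelian subgroup `H`: the set
of products `s t u`, a subgroup of `G` contained in `H` ("As `H` is abelian, the subgroups `S₀, T₀`, and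
`U₀` … form a set product `S₀T₀U₀` that is a subgroup of `H`", proof of Lemma 3.3).
[cite: Murthy2025TPPIndexP, Lemma 3.3 (proof, p. 6)] -/
def restrictedProduct (S T U : Subgroup G) : Subgroup G where
  carrier := {g | ∃ s ∈ S ⊓ H, ∃ t ∈ T ⊓ H, ∃ u ∈ U ⊓ H, s * t * u = g}
  one_mem' := ⟨1, one_mem _, 1, one_mem _, 1, one_mem _, by simp⟩
  mul_mem' := by
    rintro _ _ ⟨s, hs, t, ht, u, hu, rfl⟩ ⟨s', hs', t', ht', u', hu', rfl⟩
    refine ⟨s * s', mul_mem hs hs', t * t', mul_mem ht ht', u * u', mul_mem hu hu', ?_⟩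
    exact (mul_mul_mul_comm_mem H (Subgroup.mem_inf.1 hs').2 (Subgroup.mem_inf.1 ht).2
      (Subgroup.mem_inf.1 hu).2 (Subgroup.mem_inf.1 ht').2).symm
  inv_mem' := by
    rintro _ ⟨s, hs, t, ht, u, hu, rfl⟩
    refine ⟨s⁻¹, inv_mem hs, t⁻¹, inv_mem ht, u⁻¹, inv_mem hu, ?_⟩
    exact (inv_mul_mul_mem H (Subgroup.mem_inf.1 hs).2 (Subgroup.mem_inf.1 ht).2
      (Subgroup.mem_inf.1 hu).2).symm

variable {H}

/-- Membership in `S₀T₀U₀`, by definition. [cite: Murthy2025TPPIndexP, Lemma 3.3 (proof, p. 6)] -/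
theorem mem_restrictedProduct {S T U : Subgroup G} {g : G} :
    g ∈ restrictedProduct H S T U ↔ ∃ s ∈ S ⊓ H, ∃ t ∈ T ⊓ H, ∃ u ∈ U ⊓ H, s * t * u = g :=
  Iff.rfl

/-- `S₀T₀U₀ ≤ H`. [cite: Murthy2025TPPIndexP, Lemma 3.3 (proof, p. 6)] -/
theorem restrictedProduct_le (S T U : Subgroup G) : restrictedProduct H S T U ≤ H := by
  rintro _ ⟨s, hs, t, ht, u, hu, rfl⟩
  exact mul_mem (mul_mem (Subgroup.mem_inf.1 hs).2 (Subgroup.mem_inf.1 ht).2)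
    (Subgroup.mem_inf.1 hu).2

/-- `S₀T₀U₀ = S₀U₀T₀` (the factors commute inside `H`). [cite: Murthy2025TPPIndexP, Lemma 3.3 (1)
(proof: "by transposing T and U")] -/
theorem restrictedProduct_swap (S T U : Subgroup G) :
    restrictedProduct H S T U = restrictedProduct H S U T := by
  have key : ∀ S T U : Subgroup G, ∀ g, g ∈ restrictedProduct H S T U → g ∈ restrictedProduct H S U T := by
    rintro S T U _ ⟨s, hs, t, ht, u, hu, rfl⟩
    refine ⟨s, hs, u, hu, t, ht, ?_⟩
    have c : u * t = t * u := setLike_mul_comm (Subgroup.mem_inf.1 hu).2 (Subgroup.mem_inf.1 ht).2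
    rw [mul_assoc, c, ← mul_assoc]
  exact le_antisymm (key S T U) (key S U T)

/-- **Prop. 2.5 (2) / Obs. 3.2 (3)**: under the TPP the triple-product map
`S₀ × T₀ × U₀ → S₀T₀U₀` is a bijection (injective because `H` is abelian), so
`|S₀T₀U₀| = |S₀| |T₀| |U₀|`. [cite: Murthy2025TPPIndexP, Prop. 2.5 (2) and Obs. 3.2 (3)]
[cite: CohnUmans2003, Lemma 3.1] -/
theorem card_restrictedProduct {S T U : Subgroup G} (h : SubgroupTPP S T U) :
    Nat.card (restrictedProduct H S T U) =
      Nat.card ↥(S ⊓ H) * Nat.card ↥(T ⊓ H) * Nat.card ↥(U ⊓ H) := by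
  classical
  let f : ↥(S ⊓ H) × ↥(T ⊓ H) × ↥(U ⊓ H) → restrictedProduct H S T U :=
    fun x => ⟨(x.1 : G) * x.2.1 * x.2.2, x.1, x.1.2, x.2.1, x.2.1.2, x.2.2, x.2.2.2, rfl⟩
  have hf : Function.Bijective f := by
    constructor
    · rintro ⟨⟨s, hs⟩, ⟨t, ht⟩, ⟨u, hu⟩⟩ ⟨⟨s', hs'⟩, ⟨t', ht'⟩, ⟨u', hu'⟩⟩ hxy
      have hxy' : s * t * u = s' * t' * u' := by
        simpa [f] using congrArg (fun z : restrictedProduct H S T U => (z : G)) hxy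
      have hsH := (Subgroup.mem_inf.1 hs).2
      have htH := (Subgroup.mem_inf.1 ht).2
      have huH := (Subgroup.mem_inf.1 hu).2
      have hs'H := (Subgroup.mem_inf.1 hs').2
      have ht'H := (Subgroup.mem_inf.1 ht').2
      have hu'H := (Subgroup.mem_inf.1 hu').2
      -- the TPP word `(s'⁻¹ s)(t'⁻¹ t)(u'⁻¹ u) = (s' t' u')⁻¹ (s t u) = 1`
      have hword : s'⁻¹ * s * (t'⁻¹ * t) * (u'⁻¹ * u) = 1 := by
        have e1 : s'⁻¹ * t'⁻¹ * u'⁻¹ * (s * t * u) = s'⁻¹ * s * (t'⁻¹ * t) * (u'⁻¹ * u) :=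
          mul_mul_mul_comm_mem H hsH (inv_mem ht'H) (inv_mem hu'H) htH
        rw [← e1, ← inv_mul_mul_mem H hs'H ht'H hu'H, hxy', inv_mul_cancel]
      obtain ⟨e1, e2, e3⟩ := h _ (mul_mem (inv_mem (Subgroup.mem_inf.1 hs').1)
        (Subgroup.mem_inf.1 hs).1) _ (mul_mem (inv_mem (Subgroup.mem_inf.1 ht').1)
        (Subgroup.mem_inf.1 ht).1) _ (mul_mem (inv_mem (Subgroup.mem_inf.1 hu').1)
        (Subgroup.mem_inf.1 hu).1) hword
      have e1' : s = s' := (inv_mul_eq_one.1 e1).symm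
      have e2' : t = t' := (inv_mul_eq_one.1 e2).symm
      have e3' : u = u' := (inv_mul_eq_one.1 e3).symm
      subst e1' e2' e3'
      rfl
    · rintro ⟨g, s, hs, t, ht, u, hu, rfl⟩
      exact ⟨⟨⟨s, hs⟩, ⟨t, ht⟩, ⟨u, hu⟩⟩, rfl⟩
  rw [← Nat.card_congr (Equiv.ofBijective f hf), Nat.card_prod, Nat.card_prod, mul_assoc]

end Abelian

/-! ### Subgroups of a group with a normal subgroup of prime index (Obs. 3.2 (1)–(2)) -/

section PrimeIndex

variable (H : Subgroup G)

/-- With `[G : H] = p` prime, a subgroup `K` either lies in `H` (its `H`-support has size `σ = 1`) or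
supplements it, `KH = G` (`σ = p`). [cite: Murthy2025TPPIndexP, Obs. 3.2 (1)–(2) and proof of Thm. 4.1
("σ, τ, υ ∈ {1, p}")] -/
theorem le_or_sup_eq_top {p : ℕ} (hp : p.Prime) (hH : H.index = p) (K : Subgroup G) :
    K ≤ H ∨ K ⊔ H = ⊤ := by
  by_cases hK : K ≤ H
  · exact Or.inl hK
  right
  have hle : H ≤ K ⊔ H := le_sup_right
  have hdvd : (K ⊔ H).index ∣ p := hH ▸ Subgroup.index_dvd_of_le hle
  rcases (Nat.dvd_prime hp).1 hdvd with h1 | h2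
  · exact Subgroup.index_eq_one.1 h1
  · exfalso
    apply hK
    have hmul : H.relIndex (K ⊔ H) * (K ⊔ H).index = H.index := Subgroup.relIndex_mul_index hle
    rw [h2, hH] at hmul
    have hrel : H.relIndex (K ⊔ H) = 1 :=
      Nat.eq_of_mul_eq_mul_right hp.pos (by rw [hmul, one_mul])
    exact le_sup_left.trans (Subgroup.relIndex_eq_one.1 hrel)

/-- `σ = p`: if `KH = G` then `|K| = p · |K ∩ H|`. [cite: Murthy2025TPPIndexP, Obs. 3.2 (1)] -/
theorem card_eq_of_sup_eq_top [H.Normal] {p : ℕ} (hH : H.index = p) {K : Subgroup G}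
    (hK : K ⊔ H = ⊤) :
    Nat.card K = p * Nat.card ↥(K ⊓ H) := by
  have h1 : H.relIndex K = p := by
    rw [← Subgroup.relIndex_sup_right (H := K) (K := H), hK, Subgroup.relIndex_top_right, hH]
  have h2 : (K ⊓ H).relIndex K = H.relIndex K := Subgroup.inf_relIndex_left (H := K) (K := H)
  have h3 : (⊥ : Subgroup G).relIndex (K ⊓ H) * (K ⊓ H).relIndex K =
      (⊥ : Subgroup G).relIndex K :=
    Subgroup.relIndex_mul_relIndex (H := ⊥) (K := K ⊓ H) (L := K) bot_le inf_le_left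
  rw [Subgroup.relIndex_bot_left, Subgroup.relIndex_bot_left, h2, h1] at h3
  rw [← h3, mul_comm]

/-- `σ = 1`: if `K ≤ H` then `K ∩ H = K`. [folklore] -/
private theorem card_eq_of_le {K : Subgroup G} (hK : K ≤ H) : Nat.card K = Nat.card ↥(K ⊓ H) := by
  rw [inf_eq_left.2 hK]

/-- `|M| · [H : M] = |H|` for `M ≤ H`. [folklore] -/
private theorem card_mul_relIndex {M : Subgroup G} (hM : M ≤ H) : Nat.card M * M.relIndex H = Nat.card H := by
  have h3 : (⊥ : Subgroup G).relIndex M * M.relIndex H = (⊥ : Subgroup G).relIndex H :=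
    Subgroup.relIndex_mul_relIndex (H := ⊥) (K := M) (L := H) bot_le hM
  rwa [Subgroup.relIndex_bot_left, Subgroup.relIndex_bot_left] at h3

/-- Coset representatives inside a supplement: if `KH = G` then every coset of `H` contains an element
of `K` ("`S` is supported on all `p` cosets of `H`"). [cite: Murthy2025TPPIndexP, Def. 3.1 and proof
of Thm. 4.1] -/
theorem exists_mem_mk_eq [H.Normal] {K : Subgroup G} (hK : K ⊔ H = ⊤) (q : G ⧸ H) :
    ∃ k ∈ K, (k : G ⧸ H) = q := by
  obtain ⟨g, rfl⟩ := QuotientGroup.mk_surjective q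
  have hg : g ∈ ((K ⊔ H : Subgroup G) : Set G) := by rw [hK]; exact Subgroup.mem_top g
  rw [Subgroup.mul_normal] at hg
  obtain ⟨k, hk, x, hx, rfl⟩ := Set.mem_mul.1 hg
  refine ⟨k, hk, ?_⟩
  rw [QuotientGroup.eq]
  simpa using hx

variable [IsMulCommutative H]

/-- If `UH = G` then `U₀ = U ∩ H` is normal in `G` ("as `U₀` is normal in both `U` and `H` it is normal
in the subgroup `⟨U, H⟩` generated by them … `= G`"). [cite: Murthy2025TPPIndexP, proof of Thm. 4.1,
case (ii) (p. 8)] -/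
theorem inf_normal_of_sup_eq_top [H.Normal] {U : Subgroup G} (hU : U ⊔ H = ⊤) :
    (U ⊓ H).Normal := by
  constructor
  intro x hx g
  obtain ⟨hxU, hxH⟩ := Subgroup.mem_inf.1 hx
  have hg : g ∈ ((U ⊔ H : Subgroup G) : Set G) := by rw [hU]; exact Subgroup.mem_top g
  rw [Subgroup.mul_normal] at hg
  obtain ⟨u, hu, y, hy, rfl⟩ := Set.mem_mul.1 hg
  refine Subgroup.mem_inf.2 ⟨?_, (inferInstance : H.Normal).conj_mem x hxH (u * y)⟩
  have hc : y * x = x * y := setLike_mul_comm hy hxH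
  have e : u * y * x * (u * y)⁻¹ = u * x * u⁻¹ := by
    calc u * y * x * (u * y)⁻¹ = u * (y * x) * y⁻¹ * u⁻¹ := by group
      _ = u * (x * y) * y⁻¹ * u⁻¹ := by rw [hc]
      _ = u * x * u⁻¹ := by group
  rw [e]
  exact mul_mem (mul_mem hu hxU) (inv_mem hu)

/-! ### Lemma 3.3: the cosets `sₓ⁻¹ tₓ · S₀T₀U₀` of `S₀T₀U₀` in `H` -/

/-- **Lemma 3.3 (1)** as a word identity: if `sₓ⁻¹ tₓ ∈ S₀T₀U₀` (the coset `Sₓ⁻¹TₓU₀` is the trivial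
one) then `tₓ ∈ H`, i.e. `xH = H` — from the TPP of `(S, U, T)` applied to
`(sₓ s₀) · u₀ · (t₀ tₓ⁻¹) = 1`. [cite: Murthy2025TPPIndexP, Lemma 3.3 (1) (proof, pp. 6–7)] -/
theorem word_one {S T U : Subgroup G} (hSUT : SubgroupTPP S U T) {sx tx s0 t0 u0 : G}
    (hsx : sx ∈ S) (htx : tx ∈ T) (hs0 : s0 ∈ S ⊓ H) (ht0 : t0 ∈ T ⊓ H) (hu0 : u0 ∈ U ⊓ H)
    (hm : sx⁻¹ * tx = s0 * t0 * u0) : tx ∈ H := by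
  have c : u0 * t0 = t0 * u0 :=
    setLike_mul_comm (Subgroup.mem_inf.1 hu0).2 (Subgroup.mem_inf.1 ht0).2
  have htx' : tx = sx * (s0 * t0 * u0) := by rw [← hm]; group
  have hword : sx * s0 * u0 * (t0 * tx⁻¹) = 1 := by
    rw [htx']
    calc sx * s0 * u0 * (t0 * (sx * (s0 * t0 * u0))⁻¹)
        = sx * s0 * (u0 * t0) * u0⁻¹ * t0⁻¹ * s0⁻¹ * sx⁻¹ := by group
      _ = sx * s0 * (t0 * u0) * u0⁻¹ * t0⁻¹ * s0⁻¹ * sx⁻¹ := by rw [c]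
      _ = 1 := by group
  obtain ⟨-, -, e3⟩ := hSUT _ (mul_mem hsx (Subgroup.mem_inf.1 hs0).1) _ (Subgroup.mem_inf.1 hu0).1
    _ (mul_mem (Subgroup.mem_inf.1 ht0).1 (inv_mem htx)) hword
  have e : tx = t0 := by
    calc tx = (t0 * tx⁻¹)⁻¹ * t0 := by group
      _ = t0 := by rw [e3]; group
  rw [e]
  exact (Subgroup.mem_inf.1 ht0).2

/-- **Lemma 3.3 (2)** as a word identity: if the cosets `sₓ⁻¹tₓ · S₀T₀U₀` and `s_y⁻¹t_y · S₀T₀U₀`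
coincide, and `U₀` is normal in `G`, then `xH = yH` — from the TPP of `(S, T, U)` applied to
`(sₓ s₀⁻¹ s_y⁻¹) · (t_y t₀⁻¹ tₓ⁻¹) · û₀ = 1` with `û₀ ∈ U₀` a conjugate of `u₀⁻¹`.
[cite: Murthy2025TPPIndexP, Lemma 3.3 (2) (proof, p. 7)] -/
theorem word_two {S T U : Subgroup G} (hSTU : SubgroupTPP S T U) (hUN : (U ⊓ H).Normal)
    {sx sy tx ty s0 t0 u0 : G} (hsx : sx ∈ S) (hsy : sy ∈ S) (htx : tx ∈ T) (hty : ty ∈ T)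
    (hs0 : s0 ∈ S ⊓ H) (ht0 : t0 ∈ T ⊓ H) (hu0 : u0 ∈ U ⊓ H) (hx : sx⁻¹ * tx ∈ H)
    (hm : (sx⁻¹ * tx)⁻¹ * (sy⁻¹ * ty) = s0 * t0 * u0) : sx⁻¹ * sy ∈ H := by
  have c : sx⁻¹ * tx * s0 = s0 * (sx⁻¹ * tx) := setLike_mul_comm hx (Subgroup.mem_inf.1 hs0).2
  have hty' : ty = sy * (sx⁻¹ * tx) * (s0 * t0 * u0) := by rw [← hm]; group
  have hûU : tx * t0 * u0⁻¹ * (tx * t0)⁻¹ ∈ U :=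
    (Subgroup.mem_inf.1 (hUN.conj_mem u0⁻¹ (inv_mem hu0) (tx * t0))).1
  have hword : sx * s0⁻¹ * sy⁻¹ * (ty * t0⁻¹ * tx⁻¹) * (tx * t0 * u0⁻¹ * (tx * t0)⁻¹) = 1 := by
    rw [hty']
    calc sx * s0⁻¹ * sy⁻¹ * (sy * (sx⁻¹ * tx) * (s0 * t0 * u0) * t0⁻¹ * tx⁻¹)
          * (tx * t0 * u0⁻¹ * (tx * t0)⁻¹)
        = sx * s0⁻¹ * (sx⁻¹ * tx * s0) * tx⁻¹ := by group
      _ = sx * s0⁻¹ * (s0 * (sx⁻¹ * tx)) * tx⁻¹ := by rw [c]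
      _ = 1 := by group
  obtain ⟨e1, -, -⟩ := hSTU _
    (mul_mem (mul_mem hsx (inv_mem (Subgroup.mem_inf.1 hs0).1)) (inv_mem hsy)) _
    (mul_mem (mul_mem hty (inv_mem (Subgroup.mem_inf.1 ht0).1)) (inv_mem htx)) _ hûU hword
  have e : sx⁻¹ * sy = s0⁻¹ := by
    calc sx⁻¹ * sy = sx⁻¹ * (sx * s0⁻¹ * sy⁻¹)⁻¹ * sx * s0⁻¹ := by group
      _ = s0⁻¹ := by rw [e1]; group
  rw [e]
  exact inv_mem (Subgroup.mem_inf.1 hs0).2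

/-- **Lemma 3.3 (3)** as a word identity: if the cosets `sₓ⁻¹tₓ · S₀T₀U₀` and `s_y⁻¹u_y · S₀T₀U₀`
coincide then `xH = H` and `yH = H` — from the TPP of `(S, U, T)` applied to
`(sₓ s₀⁻¹ s_y⁻¹) · (u_y u₀⁻¹) · (t₀⁻¹ tₓ⁻¹) = 1`; no normality is needed.
[cite: Murthy2025TPPIndexP, Lemma 3.3 (3) (proof, p. 7)] -/
theorem word_three {S T U : Subgroup G} (hSUT : SubgroupTPP S U T)
    {sx sy tx uy s0 t0 u0 : G} (hsx : sx ∈ S) (hsy : sy ∈ S) (htx : tx ∈ T) (huy : uy ∈ U)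
    (hs0 : s0 ∈ S ⊓ H) (ht0 : t0 ∈ T ⊓ H) (hu0 : u0 ∈ U ⊓ H) (hx : sx⁻¹ * tx ∈ H)
    (hm : (sx⁻¹ * tx)⁻¹ * (sy⁻¹ * uy) = s0 * t0 * u0) : tx ∈ H ∧ uy ∈ H := by
  have c : sx⁻¹ * tx * s0 = s0 * (sx⁻¹ * tx) := setLike_mul_comm hx (Subgroup.mem_inf.1 hs0).2
  have huy' : uy = sy * (sx⁻¹ * tx) * (s0 * t0 * u0) := by rw [← hm]; group
  have hword : sx * s0⁻¹ * sy⁻¹ * (uy * u0⁻¹) * (t0⁻¹ * tx⁻¹) = 1 := by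
    rw [huy']
    calc sx * s0⁻¹ * sy⁻¹ * (sy * (sx⁻¹ * tx) * (s0 * t0 * u0) * u0⁻¹) * (t0⁻¹ * tx⁻¹)
        = sx * s0⁻¹ * (sx⁻¹ * tx * s0) * tx⁻¹ := by group
      _ = sx * s0⁻¹ * (s0 * (sx⁻¹ * tx)) * tx⁻¹ := by rw [c]
      _ = 1 := by group
  obtain ⟨-, e2, e3⟩ := hSUT _
    (mul_mem (mul_mem hsx (inv_mem (Subgroup.mem_inf.1 hs0).1)) (inv_mem hsy)) _
    (mul_mem huy (inv_mem (Subgroup.mem_inf.1 hu0).1)) _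
    (mul_mem (inv_mem (Subgroup.mem_inf.1 ht0).1) (inv_mem htx)) hword
  constructor
  · have e : tx = t0⁻¹ := by
      calc tx = (t0⁻¹ * tx⁻¹)⁻¹ * t0⁻¹ := by group
        _ = t0⁻¹ := by rw [e3]; group
    rw [e]
    exact inv_mem (Subgroup.mem_inf.1 ht0).2
  · have e : uy = u0 := by
      calc uy = uy * u0⁻¹ * u0 := by group
        _ = u0 := by rw [e2]; group
    rw [e]
    exact (Subgroup.mem_inf.1 hu0).2

/-! ### Thm. 4.1, proof: the two non-trivial cases `στυ = p²` and `στυ = p³` -/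

/-- **Core of the proof of Thm. 4.1.**  If `S` and `T` are supported on all `p` cosets of `H` then,
with `M = S₀T₀U₀`: either `U ≤ H`, `|S||T||U| = p² |M|` and `[H : M] ≥ 2` (case (i): the coset
`sₓ⁻¹tₓM`, `x ∉ H`, is non-trivial by Lemma 3.3 (1)), or `UH = G`, `|S||T||U| = p³ |M|` and
`[H : M] ≥ 2p − 1` (case (ii): the cosets `M`, `sₓ⁻¹tₓM`, `s_y⁻¹u_yM` for the `p − 1` non-trivial
cosets `xH`, `yH` are pairwise distinct by Lemma 3.3 (1)–(3)).
[cite: Murthy2025TPPIndexP, Thm. 4.1 (proof, pp. 7–8)] -/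
theorem core [Finite G] [H.Normal] {p : ℕ} (hp : p.Prime) (hH : H.index = p) {S T U : Subgroup G}
    (h : SubgroupTPP S T U) (hS : S ⊔ H = ⊤) (hT : T ⊔ H = ⊤) :
    (U ≤ H ∧ Nat.card S * Nat.card T * Nat.card U = p ^ 2 * Nat.card (restrictedProduct H S T U) ∧
        2 ≤ (restrictedProduct H S T U).relIndex H) ∨
    (U ⊔ H = ⊤ ∧ Nat.card S * Nat.card T * Nat.card U = p ^ 3 * Nat.card (restrictedProduct H S T U) ∧
        2 * p - 1 ≤ (restrictedProduct H S T U).relIndex H) := by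
  classical
  have hSUT : SubgroupTPP S U T := subgroupTPP_swap h
  have hcardM : Nat.card (restrictedProduct H S T U) =
      Nat.card ↥(S ⊓ H) * Nat.card ↥(T ⊓ H) * Nat.card ↥(U ⊓ H) := card_restrictedProduct h
  have hSc : Nat.card S = p * Nat.card ↥(S ⊓ H) := card_eq_of_sup_eq_top H hH hS
  have hTc : Nat.card T = p * Nat.card ↥(T ⊓ H) := card_eq_of_sup_eq_top H hH hT
  -- representatives of the cosets of `H` inside `S` and `T` (`σ = τ = p`)
  choose fS hfS hfSq using exists_mem_mk_eq H hS
  choose fT hfT hfTq using exists_mem_mk_eq H hT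
  have hxH : ∀ q, (fS q)⁻¹ * fT q ∈ H := fun q =>
    QuotientGroup.eq.1 ((hfSq q).trans (hfTq q).symm)
  -- the cosets of `M = S₀T₀U₀` in `H`
  have key : ∀ x y : H,
      (x : H ⧸ (restrictedProduct H S T U).subgroupOf H) =
        (y : H ⧸ (restrictedProduct H S T U).subgroupOf H) ↔
      (x : G)⁻¹ * (y : G) ∈ restrictedProduct H S T U := by
    intro x y
    rw [QuotientGroup.eq, Subgroup.mem_subgroupOf, Subgroup.coe_mul, Subgroup.coe_inv]
  have hrel : (restrictedProduct H S T U).relIndex H =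
      Nat.card (H ⧸ (restrictedProduct H S T U).subgroupOf H) := rfl
  -- `a q` = the coset `s_q⁻¹ t_q M`
  let a : G ⧸ H → H ⧸ (restrictedProduct H S T U).subgroupOf H :=
    fun q => ((⟨(fS q)⁻¹ * fT q, hxH q⟩ : H) : H ⧸ (restrictedProduct H S T U).subgroupOf H)
  -- Lemma 3.3 (1): `a q` is the trivial coset only for `q = H`
  have one : ∀ q, a q = ((1 : H) : H ⧸ (restrictedProduct H S T U).subgroupOf H) → q = 1 := by
    intro q hq
    obtain ⟨s0, hs0, t0, ht0, u0, hu0, e⟩ := (key _ _).1 hq.symm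
    have e' : (fS q)⁻¹ * fT q = s0 * t0 * u0 := by simpa using e.symm
    have htH : fT q ∈ H := word_one (H := H) hSUT (hfS q) (hfT q) hs0 ht0 hu0 e'
    rw [← hfTq q]
    exact (QuotientGroup.eq_one_iff _).2 htH
  rcases le_or_sup_eq_top H hp hH U with hU | hU
  · -- case (i): `στυ = p²`
    left
    refine ⟨hU, ?_, ?_⟩
    · rw [hSc, hTc, card_eq_of_le H hU, hcardM]; ring
    · have hcardQ : Nat.card (G ⧸ H) = p := by rw [← Subgroup.index_eq_card]; exact hH
      haveI hnt : Nontrivial (G ⧸ H) := by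
        rw [← Finite.one_lt_card_iff_nontrivial, hcardQ]; exact hp.one_lt
      obtain ⟨q₀, hq₀⟩ := exists_ne (1 : G ⧸ H)
      have hne : a q₀ ≠ ((1 : H) : H ⧸ (restrictedProduct H S T U).subgroupOf H) :=
        fun e => hq₀ (one q₀ e)
      haveI : Nontrivial (H ⧸ (restrictedProduct H S T U).subgroupOf H) := ⟨⟨_, _, hne⟩⟩
      rw [hrel]
      exact Finite.one_lt_card
  · -- case (ii): `στυ = p³`
    right
    have hUc : Nat.card U = p * Nat.card ↥(U ⊓ H) := card_eq_of_sup_eq_top H hH hU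
    refine ⟨hU, ?_, ?_⟩
    · rw [hSc, hTc, hUc, hcardM]; ring
    · have hUN : (U ⊓ H).Normal := inf_normal_of_sup_eq_top H hU
      have hTN : (T ⊓ H).Normal := inf_normal_of_sup_eq_top H hT
      choose fU hfU hfUq using exists_mem_mk_eq H hU
      have hyH : ∀ q, (fS q)⁻¹ * fU q ∈ H := fun q =>
        QuotientGroup.eq.1 ((hfSq q).trans (hfUq q).symm)
      -- `b q` = the coset `s_q⁻¹ u_q M`
      let b : G ⧸ H → H ⧸ (restrictedProduct H S T U).subgroupOf H :=
        fun q => ((⟨(fS q)⁻¹ * fU q, hyH q⟩ : H) : H ⧸ (restrictedProduct H S T U).subgroupOf H)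
      -- Lemma 3.3 (2): `a` is injective (uses `U₀ ⊴ G`)
      have ha : Function.Injective a := by
        intro q q' hqq'
        obtain ⟨s0, hs0, t0, ht0, u0, hu0, e⟩ := (key _ _).1 hqq'
        have hmem : (fS q)⁻¹ * fS q' ∈ H :=
          word_two (H := H) h hUN (hfS q) (hfS q') (hfT q) (hfT q') hs0 ht0 hu0 (hxH q) e.symm
        rw [← hfSq q, ← hfSq q']
        exact QuotientGroup.eq.2 hmem
      -- Lemma 3.3 (2) for `(S, U, T)`: `b` is injective (uses `T₀ ⊴ G`)
      have hb : Function.Injective b := by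
        intro q q' hqq'
        have hqq'' := (key _ _).1 hqq'
        rw [restrictedProduct_swap] at hqq''
        obtain ⟨s0, hs0, u0, hu0, t0, ht0, e⟩ := hqq''
        have hmem : (fS q)⁻¹ * fS q' ∈ H :=
          word_two (H := H) hSUT hTN (hfS q) (hfS q') (hfU q) (hfU q') hs0 hu0 ht0 (hyH q) e.symm
        rw [← hfSq q, ← hfSq q']
        exact QuotientGroup.eq.2 hmem
      -- Lemma 3.3 (3): `a q = b q'` only for `q = q' = H`
      have hab : ∀ q q', a q = b q' → q = 1 ∧ q' = 1 := by
        intro q q' hqq'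
        obtain ⟨s0, hs0, t0, ht0, u0, hu0, e⟩ := (key _ _).1 hqq'
        obtain ⟨h1, h2⟩ :=
          word_three (H := H) hSUT (hfS q) (hfS q') (hfT q) (hfU q') hs0 ht0 hu0 (hxH q) e.symm
        constructor
        · rw [← hfTq q]; exact (QuotientGroup.eq_one_iff _).2 h1
        · rw [← hfUq q']; exact (QuotientGroup.eq_one_iff _).2 h2
      -- count: `|a(G/H) ∪ b(G/H)| ≥ p + p − 1`
      haveI : Fintype (G ⧸ H) := Fintype.ofFinite _
      haveI : Fintype (H ⧸ (restrictedProduct H S T U).subgroupOf H) := Fintype.ofFinite _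
      have hcardQ : Fintype.card (G ⧸ H) = p := by
        rw [Fintype.card_eq_nat_card, ← Subgroup.index_eq_card]; exact hH
      have hA : (Finset.univ.image a).card = p := by
        rw [Finset.card_image_of_injective _ ha, Finset.card_univ, hcardQ]
      have hB : (Finset.univ.image b).card = p := by
        rw [Finset.card_image_of_injective _ hb, Finset.card_univ, hcardQ]
      have hAB : (Finset.univ.image a ∩ Finset.univ.image b).card ≤ 1 := by
        refine Finset.card_le_one.2 fun z hz z' hz' => ?_
        obtain ⟨hzA, hzB⟩ := Finset.mem_inter.1 hz
        obtain ⟨hz'A, hz'B⟩ := Finset.mem_inter.1 hz'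
        obtain ⟨q, -, rfl⟩ := Finset.mem_image.1 hzA
        obtain ⟨q', -, hq'⟩ := Finset.mem_image.1 hzB
        obtain ⟨r, -, rfl⟩ := Finset.mem_image.1 hz'A
        obtain ⟨r', -, hr'⟩ := Finset.mem_image.1 hz'B
        rw [(hab q q' hq'.symm).1, (hab r r' hr'.symm).1]
      have hunion := Finset.card_union_add_card_inter (Finset.univ.image a) (Finset.univ.image b)
      have hle : (Finset.univ.image a ∪ Finset.univ.image b).card ≤
          Fintype.card (H ⧸ (restrictedProduct H S T U).subgroupOf H) := Finset.card_le_univ _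
      rw [hrel, Nat.card_eq_fintype_card]
      omega

/-- **The case analysis of the proof of Thm. 4.1** (`σ, τ, υ ∈ {1, p}`): for any subgroup TPP
triple there is `M ≤ H` of order `|S₀||T₀||U₀|` (`M = S₀T₀U₀` up to the order of the factors) with:
`|S||T||U| ≤ |G|` (at least two of `S, T, U` inside `H`), or `|S||T||U| = p²|M|` and `[H : M] ≥ 2`
(case (i)), or `|S||T||U| = p³|M|` and `[H : M] ≥ 2p − 1` (case (ii)).
[cite: Murthy2025TPPIndexP, Thm. 4.1 (proof, pp. 7–8)] -/
theorem cases [Finite G] [H.Normal] {p : ℕ} (hp : p.Prime) (hH : H.index = p)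
    {S T U : Subgroup G} (h : SubgroupTPP S T U) :
    ∃ M : Subgroup G, M ≤ H ∧
      Nat.card M = Nat.card ↥(S ⊓ H) * Nat.card ↥(T ⊓ H) * Nat.card ↥(U ⊓ H) ∧
      (Nat.card S * Nat.card T * Nat.card U ≤ Nat.card G ∨
        (Nat.card S * Nat.card T * Nat.card U = p ^ 2 * Nat.card M ∧ 2 ≤ M.relIndex H) ∨
        (Nat.card S * Nat.card T * Nat.card U = p ^ 3 * Nat.card M ∧ 2 * p - 1 ≤ M.relIndex H)) := by
  -- the oriented statement for `S, T` supported on all cosets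
  have full : ∀ {S' T' U' : Subgroup G}, SubgroupTPP S' T' U' → S' ⊔ H = ⊤ → T' ⊔ H = ⊤ →
      ∃ M : Subgroup G, M ≤ H ∧
        Nat.card M = Nat.card ↥(S' ⊓ H) * Nat.card ↥(T' ⊓ H) * Nat.card ↥(U' ⊓ H) ∧
        (Nat.card S' * Nat.card T' * Nat.card U' ≤ Nat.card G ∨
          (Nat.card S' * Nat.card T' * Nat.card U' = p ^ 2 * Nat.card M ∧ 2 ≤ M.relIndex H) ∨
          (Nat.card S' * Nat.card T' * Nat.card U' = p ^ 3 * Nat.card M ∧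
            2 * p - 1 ≤ M.relIndex H)) := by
    intro S' T' U' h' hS' hT'
    refine ⟨restrictedProduct H S' T' U', restrictedProduct_le S' T' U', card_restrictedProduct h', ?_⟩
    rcases core H hp hH h' hS' hT' with ⟨-, h1, h2⟩ | ⟨-, h1, h2⟩
    · exact Or.inr (Or.inl ⟨h1, h2⟩)
    · exact Or.inr (Or.inr ⟨h1, h2⟩)
  -- at least two members inside `H`: `|S||T||U| ≤ p |S₀||T₀||U₀| ≤ p |H| = |G|`
  have small : ∀ {S' T' U' : Subgroup G}, SubgroupTPP S' T' U' → S' ≤ H → T' ≤ H →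
      Nat.card S' * Nat.card T' * Nat.card U' ≤ Nat.card G := by
    intro S' T' U' h' hS' hT'
    have hM := card_restrictedProduct (H := H) h'
    have hle : Nat.card (restrictedProduct H S' T' U') ≤ Nat.card H :=
      Subgroup.card_le_of_le (restrictedProduct_le S' T' U')
    have hG : Nat.card H * p = Nat.card G := by rw [← hH]; exact Subgroup.card_mul_index H
    have hUle : Nat.card U' ≤ p * Nat.card ↥(U' ⊓ H) := by
      rcases le_or_sup_eq_top H hp hH U' with hU' | hU'
      · rw [← card_eq_of_le H hU']; exact Nat.le_mul_of_pos_left _ hp.pos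
      · exact (card_eq_of_sup_eq_top H hH hU').le
    calc Nat.card S' * Nat.card T' * Nat.card U'
        ≤ Nat.card S' * Nat.card T' * (p * Nat.card ↥(U' ⊓ H)) := Nat.mul_le_mul_left _ hUle
      _ = p * Nat.card (restrictedProduct H S' T' U') := by
          rw [hM, card_eq_of_le H hS', card_eq_of_le H hT']; ring
      _ ≤ p * Nat.card H := Nat.mul_le_mul_left _ hle
      _ = Nat.card G := by rw [mul_comm, hG]
  have triv : ∀ {S' T' U' : Subgroup G}, SubgroupTPP S' T' U' →
      Nat.card S' * Nat.card T' * Nat.card U' ≤ Nat.card G →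
      ∃ M : Subgroup G, M ≤ H ∧
        Nat.card M = Nat.card ↥(S' ⊓ H) * Nat.card ↥(T' ⊓ H) * Nat.card ↥(U' ⊓ H) ∧
        (Nat.card S' * Nat.card T' * Nat.card U' ≤ Nat.card G ∨
          (Nat.card S' * Nat.card T' * Nat.card U' = p ^ 2 * Nat.card M ∧ 2 ≤ M.relIndex H) ∨
          (Nat.card S' * Nat.card T' * Nat.card U' = p ^ 3 * Nat.card M ∧
            2 * p - 1 ≤ M.relIndex H)) :=
    fun h' hle => ⟨_, restrictedProduct_le _ _ _, card_restrictedProduct h', Or.inl hle⟩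
  have eTUS : Nat.card T * Nat.card U * Nat.card S = Nat.card S * Nat.card T * Nat.card U := by ring
  have eSUT : Nat.card S * Nat.card U * Nat.card T = Nat.card S * Nat.card T * Nat.card U := by ring
  have eTUS' : Nat.card ↥(T ⊓ H) * Nat.card ↥(U ⊓ H) * Nat.card ↥(S ⊓ H) =
      Nat.card ↥(S ⊓ H) * Nat.card ↥(T ⊓ H) * Nat.card ↥(U ⊓ H) := by ring
  have eSUT' : Nat.card ↥(S ⊓ H) * Nat.card ↥(U ⊓ H) * Nat.card ↥(T ⊓ H) =
      Nat.card ↥(S ⊓ H) * Nat.card ↥(T ⊓ H) * Nat.card ↥(U ⊓ H) := by ring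
  rcases le_or_sup_eq_top H hp hH S with hS | hS <;>
    rcases le_or_sup_eq_top H hp hH T with hT | hT
  · exact triv h (small h hS hT)
  · rcases le_or_sup_eq_top H hp hH U with hU | hU
    · exact triv h (eSUT ▸ small (subgroupTPP_swap h) hS hU)
    · obtain ⟨M, hM, hc, hd⟩ := full (subgroupTPP_rotate h) hT hU
      exact ⟨M, hM, eTUS' ▸ hc, eTUS ▸ hd⟩
  · rcases le_or_sup_eq_top H hp hH U with hU | hU
    · exact triv h (eTUS ▸ small (subgroupTPP_rotate h) hT hU)
    · obtain ⟨M, hM, hc, hd⟩ := full (subgroupTPP_swap h) hS hU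
      exact ⟨M, hM, eSUT' ▸ hc, eSUT ▸ hd⟩
  · exact full h hS hT

end PrimeIndex

end Murthy2025

/-! ### Thm. 4.1 and Cor. 4.3 -/

open DihedralSubgroups Murthy2025

variable {G : Type*} [Group G]

/-- **Murthy 2025, Thm. 4.1** (`ρ₀(G) ≤ p²/(2p − 1)`, denominators cleared): if the finite group `G`
has an abelian normal subgroup `H` of prime index `p`, then every triple of subgroups `S, T, U ≤ G`
with the triple product property satisfies `(2p − 1) · |S| |T| |U| ≤ p² · |G|`.
[cite: Murthy2025TPPIndexP, Thm. 4.1] -/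
theorem Murthy2025_thm41 [Finite G] (H : Subgroup G) [H.Normal] [IsMulCommutative H] {p : ℕ}
    (hp : p.Prime) (hH : H.index = p) {S T U : Subgroup G} (h : SubgroupTPP S T U) :
    (2 * p - 1) * (Nat.card S * Nat.card T * Nat.card U) ≤ p ^ 2 * Nat.card G := by
  obtain ⟨M, hM, -, hd⟩ := Murthy2025.cases H hp hH h
  have hHM : Nat.card M * M.relIndex H = Nat.card H := card_mul_relIndex H hM
  have hG : Nat.card H * p = Nat.card G := by rw [← hH]; exact Subgroup.card_mul_index H
  have h2p : 2 * p - 1 ≤ 2 * p := Nat.sub_le _ _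
  have hp2 : 2 ≤ p := hp.two_le
  rcases hd with hd | ⟨hP, hr⟩ | ⟨hP, hr⟩
  · calc (2 * p - 1) * (Nat.card S * Nat.card T * Nat.card U)
        ≤ (2 * p - 1) * Nat.card G := Nat.mul_le_mul_left _ hd
      _ ≤ p ^ 2 * Nat.card G := by
          apply Nat.mul_le_mul_right
          calc 2 * p - 1 ≤ 2 * p := h2p
            _ ≤ p * p := Nat.mul_le_mul_right _ hp2
            _ = p ^ 2 := (pow_two p).symm
  · rw [hP, ← hG, ← hHM]
    calc (2 * p - 1) * (p ^ 2 * Nat.card M)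
        ≤ (2 * p) * (p ^ 2 * Nat.card M) := Nat.mul_le_mul_right _ h2p
      _ = p ^ 2 * (Nat.card M * 2 * p) := by ring
      _ ≤ p ^ 2 * (Nat.card M * M.relIndex H * p) :=
          Nat.mul_le_mul_left _ (Nat.mul_le_mul_right _ (Nat.mul_le_mul_left _ hr))
  · rw [hP, ← hG, ← hHM]
    calc (2 * p - 1) * (p ^ 3 * Nat.card M)
        ≤ M.relIndex H * (p ^ 3 * Nat.card M) := Nat.mul_le_mul_right _ hr
      _ = p ^ 2 * (Nat.card M * M.relIndex H * p) := by ring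

/-- **Murthy 2025, Thm. 4.1, equality clause**: if `(2p − 1) |S||T||U| = p² |G|` then `2p − 1`
divides `|H|` and `|G| = p (2p − 1) m` with `m = |S ∩ H| |T ∩ H| |U ∩ H|`, the order of the subgroup
`S₀T₀U₀` of `H` attached to the `H`-restriction of the triple.
[cite: Murthy2025TPPIndexP, Thm. 4.1 (second clause)] -/
theorem Murthy2025_thm41_eq [Finite G] (H : Subgroup G) [H.Normal] [IsMulCommutative H] {p : ℕ}
    (hp : p.Prime) (hH : H.index = p) {S T U : Subgroup G} (h : SubgroupTPP S T U)
    (heq : (2 * p - 1) * (Nat.card S * Nat.card T * Nat.card U) = p ^ 2 * Nat.card G) :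
    (2 * p - 1) ∣ Nat.card H ∧
      Nat.card G = p * (2 * p - 1) * (Nat.card ↥(S ⊓ H) * Nat.card ↥(T ⊓ H) * Nat.card ↥(U ⊓ H)) := by
  obtain ⟨M, hM, hc, hd⟩ := Murthy2025.cases H hp hH h
  have hHM : Nat.card M * M.relIndex H = Nat.card H := card_mul_relIndex H hM
  have hG : Nat.card H * p = Nat.card G := by rw [← hH]; exact Subgroup.card_mul_index H
  have hp2 : 2 ≤ p := hp.two_le
  have h2p : 2 * p - 1 < 2 * p := Nat.sub_lt (by omega) Nat.one_pos
  have hMpos : 0 < Nat.card M := Nat.card_pos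
  have hGpos : 0 < Nat.card G := Nat.card_pos
  rcases hd with hd | ⟨hP, hr⟩ | ⟨hP, hr⟩
  · exfalso
    have hlt : (2 * p - 1) * (Nat.card S * Nat.card T * Nat.card U) < p ^ 2 * Nat.card G :=
      calc (2 * p - 1) * (Nat.card S * Nat.card T * Nat.card U)
          ≤ (2 * p - 1) * Nat.card G := Nat.mul_le_mul_left _ hd
        _ < p ^ 2 * Nat.card G := by
            apply Nat.mul_lt_mul_of_pos_right _ hGpos
            calc 2 * p - 1 < 2 * p := h2p
              _ ≤ p * p := Nat.mul_le_mul_right _ hp2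
              _ = p ^ 2 := (pow_two p).symm
    exact absurd heq (ne_of_lt hlt)
  · exfalso
    have hlt : (2 * p - 1) * (Nat.card S * Nat.card T * Nat.card U) < p ^ 2 * Nat.card G := by
      rw [hP, ← hG, ← hHM]
      calc (2 * p - 1) * (p ^ 2 * Nat.card M)
          < (2 * p) * (p ^ 2 * Nat.card M) :=
            Nat.mul_lt_mul_of_pos_right h2p (Nat.mul_pos (pow_pos hp.pos 2) hMpos)
        _ = p ^ 2 * (Nat.card M * 2 * p) := by ring
        _ ≤ p ^ 2 * (Nat.card M * M.relIndex H * p) :=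
            Nat.mul_le_mul_left _ (Nat.mul_le_mul_right _ (Nat.mul_le_mul_left _ hr))
    exact absurd heq (ne_of_lt hlt)
  · have e : (2 * p - 1) * (p ^ 3 * Nat.card M) = M.relIndex H * (p ^ 3 * Nat.card M) := by
      calc (2 * p - 1) * (p ^ 3 * Nat.card M) = p ^ 2 * Nat.card G := by rw [← hP]; exact heq
        _ = M.relIndex H * (p ^ 3 * Nat.card M) := by rw [← hG, ← hHM]; ring
    have hr' : 2 * p - 1 = M.relIndex H :=
      Nat.eq_of_mul_eq_mul_right (Nat.mul_pos (pow_pos hp.pos 3) hMpos) e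
    constructor
    · exact ⟨Nat.card M, by rw [← hHM, ← hr', mul_comm]⟩
    · rw [← hG, ← hHM, ← hr', hc]; ring

/-- **Murthy 2025, Cor. 4.3 (1)**: if moreover `2p − 1 ∤ |G|` then `ρ₀(G) ≤ p/2`, i.e.
`2 · |S| |T| |U| ≤ p · |G|` for every subgroup TPP triple.
[cite: Murthy2025TPPIndexP, Cor. 4.3 (1)] -/
theorem Murthy2025_cor43_1 [Finite G] (H : Subgroup G) [H.Normal] [IsMulCommutative H] {p : ℕ}
    (hp : p.Prime) (hH : H.index = p) (hndvd : ¬ (2 * p - 1) ∣ Nat.card G) {S T U : Subgroup G}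
    (h : SubgroupTPP S T U) :
    2 * (Nat.card S * Nat.card T * Nat.card U) ≤ p * Nat.card G := by
  obtain ⟨M, hM, -, hd⟩ := Murthy2025.cases H hp hH h
  have hHM : Nat.card M * M.relIndex H = Nat.card H := card_mul_relIndex H hM
  have hG : Nat.card H * p = Nat.card G := by rw [← hH]; exact Subgroup.card_mul_index H
  have hp2 : 2 ≤ p := hp.two_le
  rcases hd with hd | ⟨hP, hr⟩ | ⟨hP, hr⟩
  · calc 2 * (Nat.card S * Nat.card T * Nat.card U) ≤ 2 * Nat.card G := Nat.mul_le_mul_left _ hd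
      _ ≤ p * Nat.card G := Nat.mul_le_mul_right _ hp2
  · rw [hP, ← hG, ← hHM]
    calc 2 * (p ^ 2 * Nat.card M) = p ^ 2 * Nat.card M * 2 := by ring
      _ ≤ p ^ 2 * Nat.card M * M.relIndex H := Nat.mul_le_mul_left _ hr
      _ = p * (Nat.card M * M.relIndex H * p) := by ring
  · have hr2 : 2 * p ≤ M.relIndex H := by
      rcases Nat.eq_or_lt_of_le hr with e | hlt
      · exfalso
        apply hndvd
        exact ⟨Nat.card M * p, by rw [← hG, ← hHM, ← e]; ring⟩
      · omega
    rw [hP, ← hG, ← hHM]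
    calc 2 * (p ^ 3 * Nat.card M) = p ^ 2 * Nat.card M * (2 * p) := by ring
      _ ≤ p ^ 2 * Nat.card M * M.relIndex H := Nat.mul_le_mul_left _ hr2
      _ = p * (Nat.card M * M.relIndex H * p) := by ring

/-- **Murthy 2025, Cor. 4.3 (2)**: a `p`-group with an abelian (normal) subgroup of index `p` has
`ρ₀ = 1`: `|S| |T| |U| ≤ |G|` for every subgroup TPP triple ("the size of any subgroup TPP triple of
`G` is a `p`-power … `< p²/(2p−1) |G| < p |G|`").  In print the normality of the index-`p` subgroup
is derived (a maximal subgroup of a `p`-group is normal); here it is a hypothesis.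
[cite: Murthy2025TPPIndexP, Cor. 4.3 (2)] -/
theorem Murthy2025_cor43_2 [Finite G] (H : Subgroup G) [H.Normal] [IsMulCommutative H] {p n : ℕ}
    (hp : p.Prime) (hH : H.index = p) (hG : Nat.card G = p ^ n) {S T U : Subgroup G}
    (h : SubgroupTPP S T U) :
    Nat.card S * Nat.card T * Nat.card U ≤ Nat.card G := by
  have h41 := Murthy2025_thm41 H hp hH h
  have hp2 : 2 ≤ p := hp.two_le
  obtain ⟨a, -, ha⟩ := (Nat.dvd_prime_pow hp).1 (hG ▸ Subgroup.card_subgroup_dvd_card S)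
  obtain ⟨b, -, hb⟩ := (Nat.dvd_prime_pow hp).1 (hG ▸ Subgroup.card_subgroup_dvd_card T)
  obtain ⟨c, -, hc⟩ := (Nat.dvd_prime_pow hp).1 (hG ▸ Subgroup.card_subgroup_dvd_card U)
  rw [ha, hb, hc, hG, ← pow_add, ← pow_add] at h41 ⊢
  by_contra hlt
  have hn : n < a + b + c := (Nat.pow_lt_pow_iff_right hp.one_lt).1 (not_le.1 hlt)
  have hlt' : p ^ 2 * p ^ n < (2 * p - 1) * p ^ (a + b + c) :=
    calc p ^ 2 * p ^ n = p * p ^ (n + 1) := by ring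
      _ < (2 * p - 1) * p ^ (n + 1) := Nat.mul_lt_mul_of_pos_right (by omega) (pow_pos hp.pos _)
      _ ≤ (2 * p - 1) * p ^ (a + b + c) := Nat.mul_le_mul_left _ (Nat.pow_le_pow_right hp.pos hn)
  exact absurd h41 (not_le.2 hlt')

/-- **Example 4.2 with `m = 1` (sharpness for `p = 2`)**: in `D₆` (Mathlib `DihedralGroup 3`, whose
rotation subgroup `⟨x⟩` has index `2`) the three reflection subgroups `⟨y⟩, ⟨yx⟩, ⟨yx²⟩` form a
subgroup TPP triple of size `8 = (4/3) · 6`, so `ρ₀(D₆) = 4/3 = p²/(2p − 1)`.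
[cite: Murthy2025TPPIndexP, Example 4.2 (p. 9)] [cite: CohnUmans2003, Prop. 18 (proof, `m = 3`)] -/
theorem Murthy2025_example42_dihedral3 :
    (Subgroup.zpowers (DihedralGroup.r 1 : DihedralGroup 3)).index = 2 ∧
    ∃ S T U : Subgroup (DihedralGroup 3), SubgroupTPP S T U ∧
      (2 * 2 - 1) * (Nat.card S * Nat.card T * Nat.card U) = 2 ^ 2 * Nat.card (DihedralGroup 3) := by
  refine ⟨?_, _, _, _, subgroupTPP_dihedral_three, ?_⟩
  · have h := Subgroup.card_mul_index (Subgroup.zpowers (DihedralGroup.r 1 : DihedralGroup 3))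
    rw [Nat.card_zpowers, DihedralGroup.orderOf_r_one, DihedralGroup.nat_card] at h
    omega
  · rw [Nat.card_zpowers, Nat.card_zpowers, Nat.card_zpowers, DihedralGroup.orderOf_sr,
      DihedralGroup.orderOf_sr, DihedralGroup.orderOf_sr, DihedralGroup.nat_card]
    decide

end Literature.Computability.AlgebraicComplexity
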